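import Summits.BirchSwinnertonDyer.BirchSwinnertonDyer.Theorems.ManinLocalTwoThreeCuspToolkitTwentySeven
import HarnessLib

/-!
# The cusp-form argument with a CUSP MULTIPLIER: `x′ = −2πi φ·y` on `ℍ` when `x, y` have poles at cusps that no symmetry
# moves to `∞` — level-free

Cell bsd-f2-manin, route `ManinLocalTwoThree` (cruxes C2 `ManinOddAtFour` stmt-22967 / C3 `ManinPrimeToThreeAtNine` stmt-22968),
prover seat p3 gen 24.  The tree's cusp-form argument (`EtaIdentityReductionThirtySix.exists_cuspForm_of`,
`EtaIdentityReductionFortyEight.exists_cuspForm_of'`/`deriv_eq_of_tendsto_pow_of`) turns the `q`-asymptotic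
`((2πi)⁻¹x′ + φ·y)/q^m → 0` at `i∞` into the identity `x′ = −2πi φ·y` on `ℍ`, PROVIDED `R = (2πi)⁻¹x′ + φ·y` tends to `0` at every
cusp; at a cusp where the Weierstrass coordinates `x, y` have a pole this was only available when a symmetry (`W = (1 0; M 1)`,
`EtaQuotientLowerUnipotent`) carries that cusp to `∞` (levels `24, 40, 48, 64`).  At level `72` (cusps `1/9`, `1/18`) and at level
`44` (cusp `1/4`) no such symmetry exists.

THE DEVICE (this file, any level `M`, any weight `k`): multiply by the square of a holomorphic modular form `h ∈ M_k(Γ₀(M))`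
chosen to vanish at the pole cusps to the order of the poles.  If, for every `A ∈ SL₂(ℤ)` off `Γ₀(M)`, the two PRODUCTS
`(h|_kA)·(x∘A)` and `(h|_kA)·(y∘A)` are bounded at `i∞` — for `η`-quotients `h, x, y` this is Ligozat's order of the product
quotient, a decidable certificate, with no expansion at the cusp — then

  `S = h²·R ∈ S_{2k+2}(Γ₀(M))`:  `(S|A) = (h|A)·((h|A)(x∘A))′/(2πi) − (h|A)′·((h|A)(x∘A))/(2πi) + (φ|A)·(h|A)·((h|A)(y∘A)) → 0`

(Cauchy: the derivative of a bounded holomorphic function tends to `0` at `i∞`; `φ|A → 0`).  With a cuspidal Sturm bound in weight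
`2k+2` and `h ≠ 0` on `ℍ` the identity `x′ = −2πi φ·y` follows (`deriv_eq_of_tendsto_pow_of_mul_sq`).  The weight-`0` companion
(`exists_modularForm_mul_of`, `eq_zero_of_mul_of`) does the same for a `Γ₀(M)`-invariant holomorphic `F` (e.g. `y² − x³ − ax − b`):
`h·F ∈ M_k(Γ₀(M))` as soon as `(h|A)·(F∘A)` is bounded at every cusp, and a plain Sturm bound kills it.

`φ` is any holomorphic function with `φ|₂A → 0` at `i∞` for all `A` (e.g. a cusp form of ANY level) and only the
`Γ₀(M)`-invariance of `R` itself is required (so `φ`, `y` may carry opposite characters — level `72`: `φ₇₂|W₃₆ = −φ₇₂`, `y∘W₃₆ = −y`).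

HONEST FRAMING: a level-free analytic lemma; nothing here proves C2, C3, Manin's conjecture or BSD; items 22967/22968 stay OPEN.
No definition, no named fact, no sorry. [cite: DiamondShurman2005, §1.2, Thm. 3.5.1] [cite: Ligozat1975, Ch. 3]
-/

set_option autoImplicit false
-- lint-debt: the directory name repeats the summit name (sibling precedent `ManinLocalTwoThreeEtaIdentityReductionFortyEight.lean`)
set_option linter.dupNamespace false

noncomputable section

open Complex Filter Topology Set Function Asymptotics
open UpperHalfPlane hiding I
open scoped Real Topology Manifold MatrixGroups ModularForm
open ModularForm CongruenceSubgroup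
open Literature.NumberTheory.EllipticCurves.ModularForms (SL2_denom_ne_zero tendsto_qParam_zpow_atImInfty)

namespace Summit.BirchSwinnertonDyer.BirchSwinnertonDyer.Theorems.ManinLocalTwoThree.CuspMultiplier

open CuspToolkit

/-! ## §1 Slash algebra: `(h²R)|_{k+k+2}A = (h|_kA)²(R|₂A)` and `(R|₂A)(τ) = (2πi)⁻¹(x∘A)′(τ) + (φ|₂A)(τ)·y(Aτ)` -/

/-- `(R|₂A)(τ) = (2πi)⁻¹ (x∘A)′(τ) + (φ|₂A)(τ) · y(Aτ)` for `R = (2πi)⁻¹x′ + φ·y` and any function `φ`. [folklore] -/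
theorem slash_two_apply (φ : ℍ → ℂ) {x : ℍ → ℂ} (y : ℍ → ℂ) (hx : MDifferentiable 𝓘(ℂ) 𝓘(ℂ) x)
    (A : SL(2, ℤ)) (τ : ℍ) :
    ((fun σ : ℍ ↦ (2 * π * I)⁻¹ * deriv (x ∘ ofComplex) σ + φ σ * y σ) ∣[(2 : ℤ)] A) τ
      = (2 * π * I)⁻¹ * deriv ((fun σ : ℍ ↦ x (A • σ)) ∘ ofComplex) τ + (φ ∣[(2 : ℤ)] A) τ * y (A • τ) := by
  rw [SL_slash_apply, SL_slash_apply, ModularGroup.denom_apply, deriv_comp_smul_ofComplex hx A τ]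
  have hJ : ((A 1 0 : ℤ) : ℂ) * (τ : ℂ) + ((A 1 1 : ℤ) : ℂ) ≠ 0 := SL2_denom_ne_zero A τ
  rw [zpow_neg, zpow_ofNat]
  field_simp

/-- `(h²·R)|_{k+k+2}A = (h|_kA)² · (R|₂A)` pointwise. [folklore] -/
theorem slash_mul_sq_apply (h R : ℍ → ℂ) (k : ℤ) (A : SL(2, ℤ)) (τ : ℍ) :
    ((fun σ : ℍ ↦ h σ ^ 2 * R σ) ∣[k + k + 2] A) τ = ((h ∣[k] A) τ) ^ 2 * (R ∣[(2 : ℤ)] A) τ := by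
  have hfun : (fun σ : ℍ ↦ h σ ^ 2 * R σ) = (h * h) * R := by
    funext σ
    simp only [Pi.mul_apply, sq]
  rw [hfun, mul_slash_SL2, mul_slash_SL2, Pi.mul_apply, Pi.mul_apply, sq]

/-- `(h·F)|_kA = (h|_kA) · (F∘A)` pointwise, for `F` of weight `0`. [folklore] -/
theorem slash_mul_weightZero_apply (h F : ℍ → ℂ) (k : ℤ) (A : SL(2, ℤ)) (τ : ℍ) :
    ((fun σ : ℍ ↦ h σ * F σ) ∣[k] A) τ = (h ∣[k] A) τ * F (A • τ) := by
  have hfun : (fun σ : ℍ ↦ h σ * F σ) = h * F := rfl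
  have hk : k = k + 0 := (add_zero k).symm
  rw [hfun, hk, mul_slash_SL2, Pi.mul_apply, add_zero]
  congr 1
  rw [SL_slash_apply, neg_zero, zpow_zero, mul_one]

/-! ## §2 At a cusp: `(h|A)²·(R|A) → 0` from the boundedness of the two products `(h|A)(x∘A)`, `(h|A)(y∘A)` -/

/-- The product of two holomorphic functions on `ℍ` is holomorphic (pointwise form). [folklore] -/
theorem mdifferentiable_mul {f g : ℍ → ℂ} (hf : MDifferentiable 𝓘(ℂ) 𝓘(ℂ) f) (hg : MDifferentiable 𝓘(ℂ) 𝓘(ℂ) g) :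
    MDifferentiable 𝓘(ℂ) 𝓘(ℂ) (fun σ : ℍ ↦ f σ * g σ) := hf.mul hg

/-- Product rule on `ℍ` through `ofComplex`: `(f·g)′ = f′·g + f·g′` at every `τ ∈ ℍ`. [folklore] -/
theorem deriv_mul_ofComplex {f g : ℍ → ℂ} (hf : MDifferentiable 𝓘(ℂ) 𝓘(ℂ) f) (hg : MDifferentiable 𝓘(ℂ) 𝓘(ℂ) g)
    (τ : ℍ) :
    deriv ((fun σ : ℍ ↦ f σ * g σ) ∘ ofComplex) τ
      = deriv (f ∘ ofComplex) τ * g τ + f τ * deriv (g ∘ ofComplex) τ := by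
  have hf' := UpperHalfPlane.mdifferentiable_iff.mp hf
  have hg' := UpperHalfPlane.mdifferentiable_iff.mp hg
  have hτ : 0 < (τ : ℂ).im := τ.im_pos
  have h1 : DifferentiableAt ℂ (f ∘ ofComplex) (τ : ℂ) :=
    (hf' _ hτ).differentiableAt (isOpen_upperHalfPlaneSet.mem_nhds hτ)
  have h2 : DifferentiableAt ℂ (g ∘ ofComplex) (τ : ℂ) :=
    (hg' _ hτ).differentiableAt (isOpen_upperHalfPlaneSet.mem_nhds hτ)
  have hfun : ((fun σ : ℍ ↦ f σ * g σ) ∘ ofComplex) = fun z ↦ (f ∘ ofComplex) z * (g ∘ ofComplex) z := by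
    funext z
    simp only [Function.comp_apply]
  rw [hfun, deriv_fun_mul h1 h2]
  simp only [Function.comp_apply, ofComplex_apply]

/-- **At a cusp `A`: `((h²R)|A) → 0`** when `h|A` is bounded and holomorphic, `φ|₂A → 0`, and the PRODUCTS `(h|A)·(x∘A)`,
`(h|A)·(y∘A)` are bounded at `i∞` (Cauchy's estimate on `(h|A)` and on `(h|A)(x∘A)`). [cite: DiamondShurman2005, §1.2] -/
theorem isZeroAtImInfty_slash_mul_sq (φ x y h : ℍ → ℂ) (k : ℤ) (hx : MDifferentiable 𝓘(ℂ) 𝓘(ℂ) x) (A : SL(2, ℤ))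
    (hφA : IsZeroAtImInfty (φ ∣[(2 : ℤ)] A))
    (hhd : MDifferentiable 𝓘(ℂ) 𝓘(ℂ) (h ∣[k] A)) (hhb : IsBoundedAtImInfty (h ∣[k] A))
    (hbx : IsBoundedAtImInfty (fun τ : ℍ ↦ (h ∣[k] A) τ * x (A • τ)))
    (hby : IsBoundedAtImInfty (fun τ : ℍ ↦ (h ∣[k] A) τ * y (A • τ))) :
    IsZeroAtImInfty ((fun σ : ℍ ↦ h σ ^ 2 * ((2 * π * I)⁻¹ * deriv (x ∘ ofComplex) σ + φ σ * y σ)) ∣[k + k + 2] A) := by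
  have hxA : MDifferentiable 𝓘(ℂ) 𝓘(ℂ) (fun σ : ℍ ↦ x (A • σ)) := mdifferentiable_comp_smul hx A
  have hP : MDifferentiable 𝓘(ℂ) 𝓘(ℂ) (fun σ : ℍ ↦ (h ∣[k] A) σ * x (A • σ)) := hhd.mul hxA
  -- the three vanishing pieces
  have h1 : IsZeroAtImInfty (fun τ : ℍ ↦ deriv ((fun σ : ℍ ↦ (h ∣[k] A) σ * x (A • σ)) ∘ ofComplex) τ) :=
    isZeroAtImInfty_deriv_of_isBoundedAtImInfty hP hbx
  have h2 : IsZeroAtImInfty (fun τ : ℍ ↦ deriv ((h ∣[k] A) ∘ ofComplex) τ) :=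
    isZeroAtImInfty_deriv_of_isBoundedAtImInfty hhd hhb
  have h12 : atImInfty.ZeroAtFilter (fun τ : ℍ ↦
      (h ∣[k] A) τ * deriv ((fun σ : ℍ ↦ (h ∣[k] A) σ * x (A • σ)) ∘ ofComplex) τ
        - deriv ((h ∣[k] A) ∘ ofComplex) τ * ((h ∣[k] A) τ * x (A • τ))) := by
    have e := (hhb.mul_zeroAtFilter h1).sub (h2.mul_boundedAtFilter hbx)
    rw [sub_zero] at e
    exact e
  have hz : IsZeroAtImInfty (fun τ : ℍ ↦
      (2 * π * I)⁻¹ * ((h ∣[k] A) τ * deriv ((fun σ : ℍ ↦ (h ∣[k] A) σ * x (A • σ)) ∘ ofComplex) τ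
        - deriv ((h ∣[k] A) ∘ ofComplex) τ * ((h ∣[k] A) τ * x (A • τ)))
      + (φ ∣[(2 : ℤ)] A) τ * (h ∣[k] A) τ * ((h ∣[k] A) τ * y (A • τ))) :=
    ((const_boundedAtFilter atImInfty ((2 * π * I)⁻¹ : ℂ)).mul_zeroAtFilter h12).add
      ((hφA.mul_boundedAtFilter hhb).mul_boundedAtFilter hby)
  refine hz.congr fun τ ↦ ?_
  rw [slash_mul_sq_apply, slash_two_apply φ y hx A τ, deriv_mul_ofComplex hhd hxA τ]
  ring

/-! ## §3 `h²·R` is a cusp form of weight `k+k+2` on `Γ₀(M)` -/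

variable {M : ℕ}

/-- `R = (2πi)⁻¹x′ + φ·y` is holomorphic on `ℍ` (as a function on the upper half-plane set). [folklore] -/
theorem differentiableOn_R {φ x y : ℍ → ℂ} (hφ : MDifferentiable 𝓘(ℂ) 𝓘(ℂ) φ) (hx : MDifferentiable 𝓘(ℂ) 𝓘(ℂ) x)
    (hy : MDifferentiable 𝓘(ℂ) 𝓘(ℂ) y) :
    MDifferentiable 𝓘(ℂ) 𝓘(ℂ) (fun σ : ℍ ↦ (2 * π * I)⁻¹ * deriv (x ∘ ofComplex) σ + φ σ * y σ) := by
  have hdiffx := UpperHalfPlane.mdifferentiable_iff.mp hx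
  rw [UpperHalfPlane.mdifferentiable_iff]
  have hD : DifferentiableOn ℂ (deriv (x ∘ ofComplex)) {z : ℂ | 0 < z.im} :=
    (hdiffx.analyticOnNhd isOpen_upperHalfPlaneSet).deriv.differentiableOn
  have hφ' := UpperHalfPlane.mdifferentiable_iff.mp hφ
  have hy' := UpperHalfPlane.mdifferentiable_iff.mp hy
  have h : DifferentiableOn ℂ (fun z : ℂ ↦ (2 * π * I)⁻¹ * deriv (x ∘ ofComplex) z
      + (φ ∘ ofComplex) z * (y ∘ ofComplex) z) {z : ℂ | 0 < z.im} :=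
    (hD.const_mul _).add (hφ'.mul hy')
  refine h.congr fun z hz ↦ ?_
  simp only [Function.comp_apply, ofComplex_apply_of_im_pos hz]

/-- **`h²·R ∈ S_{k+k+2}(Γ₀(M))`** for `R = (2πi)⁻¹x′ + φ·y`: `h ∈ M_k(Γ₀(M))`, `x, y, φ` holomorphic, `φ|₂A → 0` at `i∞` for every
`A ∈ SL₂(ℤ)`, `R|₂γ = R` for `γ ∈ Γ₀(M)`, the products `(h|A)(x∘A)`, `(h|A)(y∘A)` bounded at `i∞` for every `A ∉ Γ₀(M)`, and
`h²R → 0` at `i∞`. [cite: DiamondShurman2005, §1.2] -/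
theorem exists_cuspForm_mul_sq [NeZero M] {k k₂ : ℤ} (hk₂ : k + k + 2 = k₂) (h : ModularForm (Gamma0 M) k)
    (φ x y : ℍ → ℂ) (hφ : MDifferentiable 𝓘(ℂ) 𝓘(ℂ) φ) (hx : MDifferentiable 𝓘(ℂ) 𝓘(ℂ) x)
    (hy : MDifferentiable 𝓘(ℂ) 𝓘(ℂ) y) (hφ0 : ∀ A : SL(2, ℤ), IsZeroAtImInfty (φ ∣[(2 : ℤ)] A))
    (hR : ∀ γ : SL(2, ℤ), γ ∈ Gamma0 M →
      ((fun σ : ℍ ↦ (2 * π * I)⁻¹ * deriv (x ∘ ofComplex) σ + φ σ * y σ) ∣[(2 : ℤ)] γ)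
        = fun σ : ℍ ↦ (2 * π * I)⁻¹ * deriv (x ∘ ofComplex) σ + φ σ * y σ)
    (hbx : ∀ A : SL(2, ℤ), A ∉ Gamma0 M → IsBoundedAtImInfty (fun τ : ℍ ↦ ((⇑h) ∣[k] A) τ * x (A • τ)))
    (hby : ∀ A : SL(2, ℤ), A ∉ Gamma0 M → IsBoundedAtImInfty (fun τ : ℍ ↦ ((⇑h) ∣[k] A) τ * y (A • τ)))
    (h0 : IsZeroAtImInfty (fun σ : ℍ ↦ h σ ^ 2 * ((2 * π * I)⁻¹ * deriv (x ∘ ofComplex) σ + φ σ * y σ))) :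
    ∃ S : CuspForm (Gamma0 M) k₂, ∀ τ : ℍ, S τ = h τ ^ 2 * ((2 * π * I)⁻¹ * deriv (x ∘ ofComplex) τ + φ τ * y τ) := by
  subst hk₂
  have hinv : ∀ γ : SL(2, ℤ), γ ∈ Gamma0 M →
      ((fun σ : ℍ ↦ h σ ^ 2 * ((2 * π * I)⁻¹ * deriv (x ∘ ofComplex) σ + φ σ * y σ)) ∣[k + k + 2] γ)
        = fun σ : ℍ ↦ h σ ^ 2 * ((2 * π * I)⁻¹ * deriv (x ∘ ofComplex) σ + φ σ * y σ) := by
    intro γ hγ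
    have hh : ((⇑h) ∣[k] γ) = ⇑h := by
      have e := SlashInvariantForm.slash_action_eqn h _ ⟨γ, hγ, rfl⟩
      rw [SL_slash]
      exact e
    funext τ
    rw [slash_mul_sq_apply, hh, hR γ hγ]
  refine ⟨{ toFun := fun σ : ℍ ↦ h σ ^ 2 * ((2 * π * I)⁻¹ * deriv (x ∘ ofComplex) σ + φ σ * y σ)
            slash_action_eq' := ?_
            holo' := ?_
            zero_at_cusps' := ?_ }, fun τ ↦ rfl⟩
  · intro A hA
    obtain ⟨γ, hγ, rfl⟩ := hA
    exact hinv γ hγ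
  · exact ((ModularFormClass.holo h).pow 2).mul (differentiableOn_R hφ hx hy)
  · intro c hc
    rw [Subgroup.IsArithmetic.isCusp_iff_isCusp_SL2Z] at hc
    rw [OnePoint.isZeroAt_iff_forall_SL2Z hc]
    intro A _
    show IsZeroAtImInfty
      ((fun σ : ℍ ↦ h σ ^ 2 * ((2 * π * I)⁻¹ * deriv (x ∘ ofComplex) σ + φ σ * y σ)) ∣[k + k + 2] A)
    by_cases hA : A ∈ Gamma0 M
    · rw [hinv A hA]
      exact h0
    · exact isZeroAtImInfty_slash_mul_sq φ x y (⇑h) k hx A (hφ0 A) ((ModularFormClass.holo h).slash k _)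
        (ModularFormClass.bdd_at_infty_slash h A) (hbx A hA) (hby A hA)

/-- **The cusp-form argument with a multiplier**: if every `S ∈ S_{k₂}(Γ₀(M))` (`k₂ = 2k+2`) with `S/q^m → 0` vanishes (cuspidal
Sturm), `h ≠ 0` on `ℍ`, and `(h²R)/q^m → 0` at `i∞` (plus the cusp hypotheses of `exists_cuspForm_mul_sq`), then
`x′ = −2πi φ·y` on `ℍ`. [cite: DiamondShurman2005, §1.2, Thm. 3.5.1] -/
theorem deriv_eq_of_tendsto_pow_of_mul_sq [NeZero M] {k k₂ : ℤ} (hk₂ : k + k + 2 = k₂) (h : ModularForm (Gamma0 M) k)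
    (hh0 : ∀ τ : ℍ, h τ ≠ 0) (m : ℕ) (hm : 0 < m)
    (hS0 : ∀ S : CuspForm (Gamma0 M) k₂,
      Tendsto (fun τ : ℍ ↦ S τ / Function.Periodic.qParam 1 (τ : ℂ) ^ m) atImInfty (𝓝 0) → S = 0)
    (φ x y : ℍ → ℂ) (hφ : MDifferentiable 𝓘(ℂ) 𝓘(ℂ) φ) (hx : MDifferentiable 𝓘(ℂ) 𝓘(ℂ) x)
    (hy : MDifferentiable 𝓘(ℂ) 𝓘(ℂ) y) (hφ0 : ∀ A : SL(2, ℤ), IsZeroAtImInfty (φ ∣[(2 : ℤ)] A))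
    (hR : ∀ γ : SL(2, ℤ), γ ∈ Gamma0 M →
      ((fun σ : ℍ ↦ (2 * π * I)⁻¹ * deriv (x ∘ ofComplex) σ + φ σ * y σ) ∣[(2 : ℤ)] γ)
        = fun σ : ℍ ↦ (2 * π * I)⁻¹ * deriv (x ∘ ofComplex) σ + φ σ * y σ)
    (hbx : ∀ A : SL(2, ℤ), A ∉ Gamma0 M → IsBoundedAtImInfty (fun τ : ℍ ↦ ((⇑h) ∣[k] A) τ * x (A • τ)))
    (hby : ∀ A : SL(2, ℤ), A ∉ Gamma0 M → IsBoundedAtImInfty (fun τ : ℍ ↦ ((⇑h) ∣[k] A) τ * y (A • τ)))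
    (hlim : Tendsto (fun τ : ℍ ↦ (h τ ^ 2 * ((2 * π * I)⁻¹ * deriv (x ∘ ofComplex) τ + φ τ * y τ))
      / Function.Periodic.qParam 1 (τ : ℂ) ^ m) atImInfty (𝓝 0)) :
    ∀ τ : ℍ, deriv (x ∘ ofComplex) τ = -(2 * π * I * φ τ) * y τ := by
  have hq : Tendsto (fun τ : ℍ ↦ Function.Periodic.qParam 1 (τ : ℂ) ^ m) atImInfty (𝓝 0) := by
    have e := Literature.NumberTheory.EllipticCurves.ModularForms.tendsto_qParam_zpow_atImInfty
      (m := (m : ℤ)) (by exact_mod_cast hm)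
    simpa only [zpow_natCast] using e
  have h0 : IsZeroAtImInfty (fun σ : ℍ ↦ h σ ^ 2 * ((2 * π * I)⁻¹ * deriv (x ∘ ofComplex) σ + φ σ * y σ)) := by
    have e := hlim.mul hq
    rw [zero_mul] at e
    refine e.congr fun τ ↦ ?_
    exact div_mul_cancel₀ _ (pow_ne_zero _ (Complex.exp_ne_zero _))
  obtain ⟨S, hS⟩ := exists_cuspForm_mul_sq hk₂ h φ x y hφ hx hy hφ0 hR hbx hby h0
  have hS' : S = 0 := by
    refine hS0 S (hlim.congr fun τ ↦ ?_)
    rw [hS τ]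
  intro τ
  have e := hS τ
  rw [hS', CuspForm.zero_apply] at e
  have h2pi : (2 * π * I : ℂ) ≠ 0 := by simp [Real.pi_ne_zero, I_ne_zero]
  have hR0 : (2 * π * I)⁻¹ * deriv (x ∘ ofComplex) τ + φ τ * y τ = 0 := by
    rcases mul_eq_zero.mp e.symm with h1 | h1
    · exact absurd ((pow_eq_zero_iff two_ne_zero).mp h1) (hh0 τ)
    · exact h1
  have e' : deriv (x ∘ ofComplex) τ
      = (2 * π * I) * ((2 * π * I)⁻¹ * deriv (x ∘ ofComplex) τ + φ τ * y τ) - 2 * π * I * φ τ * y τ := by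
    field_simp
    ring
  rw [e', hR0]
  ring

/-! ## §4 The weight-`0` companion: `h·F ∈ M_k(Γ₀(M))` and `F = 0` -/

/-- **`h·F ∈ M_k(Γ₀(M))`** for a holomorphic `Γ₀(M)`-invariant `F` (weight `0`, possibly with poles at cusps) and `h ∈ M_k(Γ₀(M))`,
as soon as `(h|A)·(F∘A)` is bounded at `i∞` for every `A ∉ Γ₀(M)` and `h·F` is bounded at `i∞`. [cite: DiamondShurman2005, §1.2] -/
theorem exists_modularForm_mul_of [NeZero M] {k : ℤ} (h : ModularForm (Gamma0 M) k) (F : ℍ → ℂ)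
    (hF : MDifferentiable 𝓘(ℂ) 𝓘(ℂ) F) (hFinv : ∀ γ : SL(2, ℤ), γ ∈ Gamma0 M → ∀ τ : ℍ, F (γ • τ) = F τ)
    (hbF : ∀ A : SL(2, ℤ), A ∉ Gamma0 M → IsBoundedAtImInfty (fun τ : ℍ ↦ ((⇑h) ∣[k] A) τ * F (A • τ)))
    (h0 : IsBoundedAtImInfty (fun σ : ℍ ↦ h σ * F σ)) :
    ∃ G : ModularForm (Gamma0 M) k, ∀ τ : ℍ, G τ = h τ * F τ := by
  have hinv : ∀ γ : SL(2, ℤ), γ ∈ Gamma0 M →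
      ((fun σ : ℍ ↦ h σ * F σ) ∣[k] γ) = fun σ : ℍ ↦ h σ * F σ := by
    intro γ hγ
    have hh : ((⇑h) ∣[k] γ) = ⇑h := by
      have e := SlashInvariantForm.slash_action_eqn h _ ⟨γ, hγ, rfl⟩
      rw [SL_slash]
      exact e
    funext τ
    rw [slash_mul_weightZero_apply, hh, hFinv γ hγ τ]
  refine ⟨{ toFun := fun σ : ℍ ↦ h σ * F σ
            slash_action_eq' := ?_
            holo' := ?_
            bdd_at_cusps' := ?_ }, fun τ ↦ rfl⟩
  · intro A hA
    obtain ⟨γ, hγ, rfl⟩ := hA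
    exact hinv γ hγ
  · exact (ModularFormClass.holo h).mul hF
  · intro c hc
    rw [Subgroup.IsArithmetic.isCusp_iff_isCusp_SL2Z] at hc
    rw [OnePoint.isBoundedAt_iff_forall_SL2Z hc]
    intro A _
    show IsBoundedAtImInfty ((fun σ : ℍ ↦ h σ * F σ) ∣[k] A)
    by_cases hA : A ∈ Gamma0 M
    · rw [hinv A hA]
      exact h0
    · have hfun : ((fun σ : ℍ ↦ h σ * F σ) ∣[k] A) = fun τ : ℍ ↦ ((⇑h) ∣[k] A) τ * F (A • τ) :=
        funext (slash_mul_weightZero_apply (⇑h) F k A)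
      rw [hfun]
      exact hbF A hA

/-- **The weight-`0` multiplier argument**: if moreover every `G ∈ M_k(Γ₀(M))` with `G = O(e^{−2πm Im τ})` vanishes (Sturm),
`h ≠ 0` on `ℍ` and `h·F = O(e^{−2πm Im τ})` at `i∞`, then `F = 0` on `ℍ`. [cite: DiamondShurman2005, Thm. 3.5.1] -/
theorem eq_zero_of_mul_of [NeZero M] {k : ℤ} (h : ModularForm (Gamma0 M) k) (hh0 : ∀ τ : ℍ, h τ ≠ 0) (m : ℝ) (hm : 0 ≤ m)
    (hG0 : ∀ G : ModularForm (Gamma0 M) k,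
      ((⇑G) =O[atImInfty] fun τ : ℍ ↦ Real.exp (-2 * π * m * τ.im)) → (⇑G) = 0)
    (F : ℍ → ℂ) (hF : MDifferentiable 𝓘(ℂ) 𝓘(ℂ) F)
    (hFinv : ∀ γ : SL(2, ℤ), γ ∈ Gamma0 M → ∀ τ : ℍ, F (γ • τ) = F τ)
    (hbF : ∀ A : SL(2, ℤ), A ∉ Gamma0 M → IsBoundedAtImInfty (fun τ : ℍ ↦ ((⇑h) ∣[k] A) τ * F (A • τ)))
    (hdecay : (fun σ : ℍ ↦ h σ * F σ) =O[atImInfty] fun τ : ℍ ↦ Real.exp (-2 * π * m * τ.im)) :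
    ∀ τ : ℍ, F τ = 0 := by
  have h0 : IsBoundedAtImInfty (fun σ : ℍ ↦ h σ * F σ) := by
    refine hdecay.trans ?_
    refine Asymptotics.IsBigO.of_bound 1 ?_
    filter_upwards [Filter.Eventually.of_forall (fun _ : ℍ ↦ trivial)] with τ _
    rw [Pi.one_apply, norm_one, one_mul, Real.norm_eq_abs, abs_of_pos (Real.exp_pos _), Real.exp_le_one_iff]
    have : 0 ≤ 2 * π * m * τ.im := by
      have h1 : 0 ≤ τ.im := τ.im_pos.le
      positivity
    linarith
  obtain ⟨G, hG⟩ := exists_modularForm_mul_of h F hF hFinv hbF h0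
  have hcoe : (⇑G) = fun σ : ℍ ↦ h σ * F σ := funext hG
  have hGz : (⇑G) = 0 := hG0 G (by rw [hcoe]; exact hdecay)
  intro τ
  have e := congrFun hGz τ
  rw [hG τ, Pi.zero_apply] at e
  rcases mul_eq_zero.mp e with h1 | h1
  · exact absurd h1 (hh0 τ)
  · exact h1

end Summit.BirchSwinnertonDyer.BirchSwinnertonDyer.Theorems.ManinLocalTwoThree.CuspMultiplier

end
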